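import Literature.MathematicalPhysics.QuantumFieldTheory.OSDistributionSpace
import Mathlib.Analysis.InnerProductSpace.Positive
import HarnessLib

/-!
# The OS time-translation semigroup: strong continuity, positivity, self-adjointness

Osterwalder–Schrader I (CMP 31 (1973)), §4.1, p. 92, text after (4.9): "`{T^t}_{t ≥ 0}` is a
weakly continuous one parameter semigroup of self-adjoint contractions on `ℋ`. Let `H` be its
infinitesimal generator. It is a positive self-adjoint operator …"; Glimm–Jaffe, *Quantum
Physics* (2nd ed. 1987), Thm. 6.1.3: reflection positivity yields a Hilbert space `ℋ` and "a
strongly continuous, self-adjoint contraction semigroup `e^{-tH}`, `0 ≤ H`, `HΩ = 0`".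

`Literature.MathematicalPhysics.QuantumFieldTheory.OSDistributionSpace` constructs, for a
Schwinger family `𝔖` with E2 (and E1 for the semigroup), the OS Hilbert space
`OSHilbert 𝔖 hE2` and the contraction semigroup `shiftH hE2 t` (`e^{-tH}`): contraction,
semigroup law, symmetry, `e^{-tH} Ω = Ω`. This file adds the remaining clauses of the two
quotations that do not require a spectral theorem:

* **weak continuity on the pre-Hilbert space** (`continuous_inner_shiftOp`): for finite
  combinations of generators, `t ↦ ⟪v, T(t) w⟫ = ∑ c̄ᵢ dⱼ 𝔖(ΘFᵢ* ⊗ (Gⱼ)_t)` is continuous, because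
  translation is continuous on `𝓢` (`continuous_compSubConstCLM`) and the OS pairing is jointly
  continuous (`SchwingerFamily.tendsto_osPairing`);
* **strong continuity on `ℋ`** (`tendsto_shiftH_nhds_zero`, `continuous_shiftH_apply`):
  `‖T(t)v − v‖² ≤ 2(‖v‖² − Re ⟪v, T(t)v⟫)` for a symmetric contraction, then density of the
  pre-Hilbert space and `‖T(t)‖ ≤ 1` (the standard `3ε` argument), and
  `‖T(t)ψ − T(s)ψ‖ ≤ ‖T(|t − s|)ψ − ψ‖`;
* **self-adjointness and positivity** of each `e^{-tH}` as a bounded operator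
  (`isSelfAdjoint_shiftH`, `inner_shiftH_self_eq_norm_sq` : `⟪ψ, e^{-tH}ψ⟫ = ‖e^{-tH/2}ψ‖²`,
  `isPositive_shiftH`, `shiftH_nonneg` in the Loewner order of `ℋ →L[ℂ] ℋ`), and the square-root
  relation `e^{-tH/2} * e^{-tH/2} = e^{-tH}` (`shiftH_half_mul_shiftH_half`), the entry point to
  Mathlib's continuous functional calculus (`CFC.sqrt_unique`) for the holomorphic extension;
* the **positive-definiteness of the orbit kernel** on the semigroup `(ℝ≥0, +)`,
  `∑ᵢⱼ c̄ᵢ cⱼ ⟪ψ, T(tᵢ + tⱼ)ψ⟫ = ‖∑ⱼ cⱼ T(tⱼ)ψ‖² ≥ 0` (`sum_sum_inner_shiftH_add_nonneg`), the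
  hypothesis of the Bernstein–Widder / Berg–Christensen–Ressel representation
  `⟪ψ, T(t)ψ⟫ = ∫ e^{-tλ} dμ_ψ(λ)` by which OS's holomorphic semigroup `T^τ`, `Re τ ≥ 0`, can be
  obtained without the spectral theorem.

Not here (next steps towards `OS1975_exists_continuation_halfSpace`): the identification
`e^{-tH} = (e^{-H})^t` in the continuous functional calculus, the scalar spectral measures and
the holomorphic semigroup `e^{-τH}`, `Re τ > 0`.

## References
* K. Osterwalder, R. Schrader, Axioms for Euclidean Green's functions, CMP 31 (1973), §4.1,
  p. 92 (text between (4.9) and (4.10)).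
* J. Glimm, A. Jaffe, Quantum Physics (2nd ed. 1987), §6.1, Thm. 6.1.3.
-/

noncomputable section

open Filter
open _root_.Topology ComplexConjugate
open scoped InnerProductSpace SchwartzMap ComplexOrder

namespace Literature.MathematicalPhysics.QuantumFieldTheory

variable {d : ℕ} [NeZero d]

section SchwingerFamily
open Literature.MathematicalPhysics.QuantumLattice (SchwingerFamily)
open Literature.MathematicalPhysics.QuantumLattice.SchwingerFamily
open Literature.MathematicalPhysics.QuantumLattice.SchwingerFamily.OSSpace

variable (𝔖 : SchwingerFamily (EuclideanSpace ℝ (Fin d)))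

/-! ## Weak continuity on generators and on the pre-Hilbert space -/

/-- In a complex inner product space, `0 ≤ ⟪x, x⟫` for Mathlib's partial order on `ℂ`
(`⟪x, x⟫ = ‖x‖²`). [folklore] -/
theorem inner_self_nonneg_complex {E : Type*} [NormedAddCommGroup E] [InnerProductSpace ℂ E]
    (x : E) : (0 : ℂ) ≤ ⟪x, x⟫_ℂ := by
  have h : ⟪x, x⟫_ℂ = ((‖x‖ ^ 2 : ℝ) : ℂ) := by
    rw [inner_self_eq_norm_sq_to_K]; norm_cast
  rw [h]
  exact Complex.zero_le_real.2 (sq_nonneg _)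


/-- **Continuity of time translation on test functions**: `t ↦ F(· − t e₀)` is continuous
`ℝ → 𝓢` (translation is continuous on the Schwartz space, `continuous_compSubConstCLM`, and
`t ↦ t e₀` is continuous, `continuous_single_time`). [folklore] -/
theorem _root_.Literature.MathematicalPhysics.QuantumLattice.SchwingerFamily.continuous_translateMulti_timeVec {n : ℕ}
    (F : 𝓢((Fin n → EuclideanSpace ℝ (Fin d)), ℂ)) :
    Continuous fun t : ℝ => QuantumLattice.translateMulti (timeVec t) F := by
  change Continuous fun t : ℝ =>
    SchwartzMap.compSubConstCLM ℂ (fun _ : Fin n => timeVec (d := d) t) F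
  exact (QuantumLattice.continuous_compSubConstCLM (𝕜 := ℂ) F).comp
    (continuous_pi fun _ => QuantumLattice.continuous_single_time d)

/-- The pairing of a generator with a time-translated generator, written with `max t 0` so that
the junk convention (`shiftGen t = id` for `t < 0`) is absorbed:
`𝔖(ΘF_p* ⊗ (F_q)_{t ∨ 0})`. [folklore] -/
theorem _root_.Literature.MathematicalPhysics.QuantumLattice.SchwingerFamily.genPairing_shiftGen_eq_osPairing (p q : PosGen d) (t : ℝ) :
    genPairing 𝔖 p (shiftGen t q) =
      𝔖.osPairing p.2.1 (QuantumLattice.translateMulti (timeVec (max t 0)) q.2.1) := by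
  rcases le_or_gt 0 t with ht | ht
  · rw [shiftGen_of_nonneg ht, max_eq_left ht]
    rfl
  · rw [shiftGen_of_neg ht, max_eq_right ht.le, timeVec_zero, QuantumLattice.translateMulti_zero]
    rfl

/-- **Weak continuity on generators** (Osterwalder–Schrader I (1973), p. 92: "`{T^t}` is a weakly
continuous one parameter semigroup"): `t ↦ 𝔖(ΘF_p* ⊗ (F_q)_t)` is continuous (joint continuity
of the OS pairing and continuity of translations on `𝓢`). [cite: OsterwalderSchraderCMP1973, §4.1 p. 92] -/
theorem _root_.Literature.MathematicalPhysics.QuantumLattice.SchwingerFamily.continuous_genPairing_shiftGen (p q : PosGen d) :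
    Continuous fun t : ℝ => genPairing 𝔖 p (shiftGen t q) := by
  simp only [genPairing_shiftGen_eq_osPairing]
  refine continuous_iff_continuousAt.2 fun t₀ => ?_
  exact 𝔖.tendsto_osPairing tendsto_const_nhds
    (((continuous_translateMulti_timeVec q.2.1).comp (continuous_id.max continuous_const)).tendsto t₀)

section OSSpace

variable {𝔖} {hE2 : 𝔖.IsOSReflectionPositive}

/-- **Weak continuity of `T(t)` on the pre-Hilbert space**: `t ↦ ⟪v, T(t) w⟫` is continuous for
all `v, w ∈ OSSpace` (finite combinations of generators). [cite: OsterwalderSchraderCMP1973, §4.1 p. 92] -/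
theorem _root_.Literature.MathematicalPhysics.QuantumLattice.SchwingerFamily.OSSpace.continuous_inner_shiftOp (v w : OSSpace 𝔖 hE2) :
    Continuous fun t : ℝ => ⟪v, shiftOp 𝔖 hE2 t w⟫_ℂ := by
  rw [← of_symm_eq v, ← of_symm_eq w]
  generalize (OSSpace.of 𝔖 hE2).symm v = u
  generalize (OSSpace.of 𝔖 hE2).symm w = u'
  have h : (fun t : ℝ => ⟪OSSpace.of 𝔖 hE2 u, shiftOp 𝔖 hE2 t (OSSpace.of 𝔖 hE2 u')⟫_ℂ) =
      fun t => ∑ p ∈ u.support, ∑ q ∈ u'.support,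
        conj (u p) * u' q * genPairing 𝔖 p (shiftGen t q) := by
    funext t
    rw [shiftOp_of, inner_def]
    simp only [LinearEquiv.symm_apply_apply]
    rw [← (Finsupp.mapDomain_id : Finsupp.mapDomain id u = u), osFormFree_mapDomain,
      Finsupp.mapDomain_id]
    rfl
  rw [h]
  exact continuous_finsetSum _ fun p _ => continuous_finsetSum _ fun q _ =>
    continuous_const.mul (continuous_genPairing_shiftGen 𝔖 p q)

/-- **Strong continuity at `0` on the pre-Hilbert space**: `T(t) v → v` as `t → 0`. For `t ≥ 0`,
`‖T(t)v − v‖² = ‖T(t)v‖² − 2 Re⟪T(t)v, v⟫ + ‖v‖² ≤ 2(‖v‖² − Re⟪v, T(t)v⟫)` by the contraction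
property and symmetry, and the right side tends to `0` by weak continuity; for `t < 0`,
`T(t) = 1`. [cite: GlimmJaffeQP1987, Thm. 6.1.3] -/
theorem _root_.Literature.MathematicalPhysics.QuantumLattice.SchwingerFamily.OSSpace.tendsto_shiftOp_nhds_zero (hE1 : 𝔖.IsEuclideanCovariant)
    (v : OSSpace 𝔖 hE2) : Tendsto (fun t : ℝ => shiftOp 𝔖 hE2 t v) (𝓝 0) (𝓝 v) := by
  -- the bound `‖T(t)v − v‖² ≤ 2 (‖v‖² − Re ⟪v, T(t) v⟫)` for all `t`
  have hbound : ∀ t : ℝ, ‖shiftOp 𝔖 hE2 t v - v‖ ^ 2 ≤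
      2 * (‖v‖ ^ 2 - RCLike.re ⟪v, shiftOp 𝔖 hE2 t v⟫_ℂ) := by
    intro t
    rcases le_or_gt 0 t with ht | ht
    · rw [@norm_sub_sq ℂ, inner_shiftOp_left hE1 ht]
      have h1 : ‖shiftOp 𝔖 hE2 t v‖ ^ 2 ≤ ‖v‖ ^ 2 :=
        pow_le_pow_left₀ (norm_nonneg _) (norm_shiftOp_le hE1 t v) 2
      linarith
    · rw [shiftOp_of_neg ht, LinearMap.id_apply, sub_self, norm_zero, inner_self_eq_norm_sq]
      simp
  -- the right side tends to `0`
  have hlim : Tendsto (fun t : ℝ => 2 * (‖v‖ ^ 2 - RCLike.re ⟪v, shiftOp 𝔖 hE2 t v⟫_ℂ))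
      (𝓝 0) (𝓝 0) := by
    have hc : Continuous fun t : ℝ => 2 * (‖v‖ ^ 2 - RCLike.re ⟪v, shiftOp 𝔖 hE2 t v⟫_ℂ) :=
      continuous_const.mul (continuous_const.sub
        (RCLike.continuous_re.comp (continuous_inner_shiftOp v v)))
    have h0 := hc.tendsto 0
    simp only [shiftOp_zero, LinearMap.id_apply, inner_self_eq_norm_sq, sub_self,
      mul_zero] at h0
    exact h0
  have hsq : Tendsto (fun t : ℝ => ‖shiftOp 𝔖 hE2 t v - v‖ ^ 2) (𝓝 0) (𝓝 0) :=
    squeeze_zero (fun t => by positivity) hbound hlim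
  rw [tendsto_iff_norm_sub_tendsto_zero]
  have := hsq.sqrt
  simpa [Real.sqrt_sq (norm_nonneg _)] using this

/-! ## Strong continuity on the Hilbert space -/

/-- `e^{-tH} = 1` for `t < 0` (junk convention, by density from `shiftOp_of_neg`). [folklore] -/
theorem _root_.Literature.MathematicalPhysics.QuantumLattice.SchwingerFamily.OSSpace.shiftH_of_neg (hE1 : 𝔖.IsEuclideanCovariant) {t : ℝ} (ht : t < 0) :
    shiftH hE2 t = 1 := by
  refine ContinuousLinearMap.ext fun ψ => ?_
  refine denseRange_ι.induction_on ψ (isClosed_eq (shiftH hE2 t).continuous continuous_id) fun v => ?_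
  rw [shiftH_ι hE1 t, shiftOp_of_neg ht, LinearMap.id_apply]
  rfl

/-- `e^{-(t ∨ 0)H} = e^{-tH}` (the junk convention in one formula). [folklore] -/
theorem _root_.Literature.MathematicalPhysics.QuantumLattice.SchwingerFamily.OSSpace.shiftH_max (hE1 : 𝔖.IsEuclideanCovariant) (t : ℝ) :
    shiftH hE2 (max t 0) = shiftH hE2 t := by
  rcases le_or_gt 0 t with ht | ht
  · rw [max_eq_left ht]
  · rw [max_eq_right ht.le, shiftH_of_neg hE1 ht]
    exact ContinuousLinearMap.ext fun ψ => shiftH_zero_apply hE1 ψ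

/-- **Strong continuity of `e^{-tH}` at `t = 0`**: `e^{-tH} ψ → ψ` as `t → 0`, for every `ψ ∈ ℋ`
(from the pre-Hilbert space by density and `‖e^{-tH}‖ ≤ 1`; Glimm–Jaffe Thm. 6.1.3: "strongly
continuous … contraction semigroup"). [cite: GlimmJaffeQP1987, Thm. 6.1.3] -/
theorem _root_.Literature.MathematicalPhysics.QuantumLattice.SchwingerFamily.OSSpace.tendsto_shiftH_nhds_zero (hE1 : 𝔖.IsEuclideanCovariant)
    (ψ : OSHilbert 𝔖 hE2) : Tendsto (fun t : ℝ => shiftH hE2 t ψ) (𝓝 0) (𝓝 ψ) := by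
  refine Metric.tendsto_nhds.2 fun ε hε => ?_
  obtain ⟨v, hv⟩ := denseRange_ι.exists_dist_lt ψ (ε := ε / 3) (by positivity)
  have hv3 : Tendsto (fun t : ℝ => shiftH hE2 t (ι 𝔖 hE2 v)) (𝓝 0) (𝓝 (ι 𝔖 hE2 v)) := by
    simp only [shiftH_ι hE1]
    exact ((ι 𝔖 hE2).continuous.tendsto v).comp (tendsto_shiftOp_nhds_zero hE1 v)
  filter_upwards [Metric.tendsto_nhds.1 hv3 (ε / 3) (by positivity)] with t ht
  have h1 : dist (shiftH hE2 t ψ) (shiftH hE2 t (ι 𝔖 hE2 v)) ≤ dist ψ (ι 𝔖 hE2 v) := by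
    rw [dist_eq_norm, dist_eq_norm, ← map_sub]
    exact norm_shiftH_le hE1 t _
  calc dist (shiftH hE2 t ψ) ψ
      ≤ dist (shiftH hE2 t ψ) (shiftH hE2 t (ι 𝔖 hE2 v)) +
          dist (shiftH hE2 t (ι 𝔖 hE2 v)) (ι 𝔖 hE2 v) + dist (ι 𝔖 hE2 v) ψ :=
        dist_triangle4 _ _ _ _
    _ < ε / 3 + ε / 3 + ε / 3 := by
        gcongr
        · exact h1.trans_lt hv
        · rwa [dist_comm]
    _ = ε := by ring

/-- The semigroup estimate `‖e^{-tH}ψ − e^{-sH}ψ‖ ≤ ‖e^{-|t−s|H}ψ − ψ‖` for `s, t ≥ 0` (factor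
out `e^{-min(s,t)H}`, a contraction). [folklore] -/
theorem _root_.Literature.MathematicalPhysics.QuantumLattice.SchwingerFamily.OSSpace.norm_shiftH_sub_shiftH_le (hE1 : 𝔖.IsEuclideanCovariant) {s t : ℝ}
    (hs : 0 ≤ s) (ht : 0 ≤ t) (ψ : OSHilbert 𝔖 hE2) :
    ‖shiftH hE2 t ψ - shiftH hE2 s ψ‖ ≤ ‖shiftH hE2 |t - s| ψ - ψ‖ := by
  wlog hst : s ≤ t generalizing s t
  · rw [norm_sub_rev, abs_sub_comm]
    exact this ht hs (le_of_not_ge hst)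
  rw [abs_of_nonneg (sub_nonneg.2 hst)]
  have h : shiftH hE2 t ψ = shiftH hE2 s (shiftH hE2 (t - s) ψ) := by
    rw [← shiftH_add_apply hE1 hs (sub_nonneg.2 hst), add_sub_cancel]
  rw [h, ← map_sub]
  exact norm_shiftH_le hE1 s _

/-- **Strong continuity of the OS semigroup** (Glimm–Jaffe Thm. 6.1.3; Osterwalder–Schrader I
(1973), p. 92): for every `ψ ∈ ℋ`, `t ↦ e^{-tH} ψ` is continuous on `ℝ` (constant `= ψ` for
`t ≤ 0` by the junk convention). [cite: GlimmJaffeQP1987, Thm. 6.1.3] -/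
theorem _root_.Literature.MathematicalPhysics.QuantumLattice.SchwingerFamily.OSSpace.continuous_shiftH_apply (hE1 : 𝔖.IsEuclideanCovariant) (ψ : OSHilbert 𝔖 hE2) :
    Continuous fun t : ℝ => shiftH hE2 t ψ := by
  have hre : (fun t : ℝ => shiftH hE2 t ψ) = fun t => shiftH hE2 (max t 0) ψ := by
    funext t; rw [shiftH_max hE1]
  rw [hre]
  refine continuous_iff_continuousAt.2 fun t₀ => ?_
  rw [ContinuousAt, tendsto_iff_norm_sub_tendsto_zero]
  have hb : ∀ t : ℝ, ‖shiftH hE2 (max t 0) ψ - shiftH hE2 (max t₀ 0) ψ‖ ≤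
      ‖shiftH hE2 |max t 0 - max t₀ 0| ψ - ψ‖ := fun t =>
    norm_shiftH_sub_shiftH_le hE1 (le_max_right _ _) (le_max_right _ _) ψ
  refine squeeze_zero (fun t => norm_nonneg _) hb ?_
  have h0 : Tendsto (fun t : ℝ => |max t 0 - max t₀ 0|) (𝓝 t₀) (𝓝 0) := by
    have hc : Continuous fun t : ℝ => |max t 0 - max t₀ 0| := by fun_prop
    simpa using hc.tendsto t₀
  have := ((tendsto_shiftH_nhds_zero hE1 ψ).comp h0)
  rw [tendsto_iff_norm_sub_tendsto_zero] at this
  exact this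

/-- Joint form of strong continuity used for matrix elements: `t ↦ ⟪φ, e^{-tH} ψ⟫` is
continuous. [folklore] -/
theorem _root_.Literature.MathematicalPhysics.QuantumLattice.SchwingerFamily.OSSpace.continuous_inner_shiftH (hE1 : 𝔖.IsEuclideanCovariant) (φ ψ : OSHilbert 𝔖 hE2) :
    Continuous fun t : ℝ => ⟪φ, shiftH hE2 t ψ⟫_ℂ :=
  continuous_const.inner (continuous_shiftH_apply hE1 ψ)

/-! ## Self-adjointness and positivity of `e^{-tH}` -/

/-- Symmetry of `e^{-tH}` for every real `t` (for `t < 0` the operator is `1`). [folklore] -/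
theorem _root_.Literature.MathematicalPhysics.QuantumLattice.SchwingerFamily.OSSpace.inner_shiftH_left' (hE1 : 𝔖.IsEuclideanCovariant) (t : ℝ)
    (φ ψ : OSHilbert 𝔖 hE2) : ⟪shiftH hE2 t φ, ψ⟫_ℂ = ⟪φ, shiftH hE2 t ψ⟫_ℂ := by
  rcases le_or_gt 0 t with ht | ht
  · exact inner_shiftH_left hE1 ht φ ψ
  · rw [shiftH_of_neg hE1 ht, one_apply_eq_self, one_apply_eq_self]

/-- **`e^{-tH}` is self-adjoint** as a bounded operator on `ℋ` (Osterwalder–Schrader I (1973),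
p. 92: "semigroup of self-adjoint contractions"). [cite: OsterwalderSchraderCMP1973, §4.1 p. 92] -/
theorem _root_.Literature.MathematicalPhysics.QuantumLattice.SchwingerFamily.OSSpace.isSelfAdjoint_shiftH (hE1 : 𝔖.IsEuclideanCovariant) (t : ℝ) :
    IsSelfAdjoint (shiftH hE2 t) := by
  rw [ContinuousLinearMap.isSelfAdjoint_iff_isSymmetric]
  exact fun φ ψ => inner_shiftH_left' hE1 t φ ψ

/-- The square-root relation `e^{-(t/2)H} e^{-(t/2)H} = e^{-tH}`, `t ≥ 0` (semigroup law), as an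
identity in the algebra `ℋ →L[ℂ] ℋ`. [folklore] -/
theorem _root_.Literature.MathematicalPhysics.QuantumLattice.SchwingerFamily.OSSpace.shiftH_half_mul_shiftH_half (hE1 : 𝔖.IsEuclideanCovariant) {t : ℝ} (ht : 0 ≤ t) :
    shiftH hE2 (t / 2) * shiftH hE2 (t / 2) = shiftH hE2 t := by
  refine ContinuousLinearMap.ext fun ψ => ?_
  rw [mul_apply_eq_comp, ← shiftH_add_apply hE1 (by positivity) (by positivity),
    add_halves]

/-- **`⟪ψ, e^{-tH} ψ⟫ = ‖e^{-(t/2)H} ψ‖²`** for `t ≥ 0`: the matrix elements of the semigroup on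
the diagonal are squares of norms (symmetry and the semigroup law). [folklore] -/
theorem _root_.Literature.MathematicalPhysics.QuantumLattice.SchwingerFamily.OSSpace.inner_shiftH_self_eq_norm_sq (hE1 : 𝔖.IsEuclideanCovariant) {t : ℝ} (ht : 0 ≤ t)
    (ψ : OSHilbert 𝔖 hE2) :
    ⟪ψ, shiftH hE2 t ψ⟫_ℂ = ((‖shiftH hE2 (t / 2) ψ‖ ^ 2 : ℝ) : ℂ) := by
  rw [← shiftH_half_mul_shiftH_half hE1 ht, mul_apply_eq_comp,
    ← inner_shiftH_left hE1 (by positivity), inner_self_eq_norm_sq_to_K]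
  norm_cast

/-- **Positivity of the matrix elements**: `0 ≤ ⟪ψ, e^{-tH} ψ⟫` (a real, nonnegative number;
Mathlib's order on `ℂ`). For `t < 0` the operator is `1`. [cite: OsterwalderSchraderCMP1973, §4.1 p. 92] -/
theorem _root_.Literature.MathematicalPhysics.QuantumLattice.SchwingerFamily.OSSpace.inner_shiftH_self_nonneg (hE1 : 𝔖.IsEuclideanCovariant) (t : ℝ) (ψ : OSHilbert 𝔖 hE2) :
    0 ≤ ⟪ψ, shiftH hE2 t ψ⟫_ℂ := by
  rcases le_or_gt 0 t with ht | ht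
  · rw [inner_shiftH_self_eq_norm_sq hE1 ht]
    exact_mod_cast sq_nonneg ‖shiftH hE2 (t / 2) ψ‖
  · rw [shiftH_of_neg hE1 ht, one_apply_eq_self]
    exact inner_self_nonneg_complex ψ

/-- **`e^{-tH}` is a positive operator** (`ContinuousLinearMap.IsPositive`: symmetric with
`0 ≤ ⟪e^{-tH}ψ, ψ⟫`), i.e. `e^{-tH} = (e^{-tH/2})* e^{-tH/2} ≥ 0` (Osterwalder–Schrader I (1973),
p. 92: "`T₀^t` is positive, symmetric and has norm smaller or equal to one"). [cite: OsterwalderSchraderCMP1973, §4.1 p. 92] -/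
theorem _root_.Literature.MathematicalPhysics.QuantumLattice.SchwingerFamily.OSSpace.isPositive_shiftH (hE1 : 𝔖.IsEuclideanCovariant) (t : ℝ) :
    (shiftH hE2 t).IsPositive := by
  rw [ContinuousLinearMap.isPositive_iff']
  refine ⟨isSelfAdjoint_shiftH hE1 t, fun ψ => ?_⟩
  rw [inner_shiftH_left' hE1 t ψ ψ]
  exact inner_shiftH_self_nonneg hE1 t ψ

/-- `0 ≤ e^{-tH}` in the Loewner order of `ℋ →L[ℂ] ℋ` (the form in which Mathlib's continuous
functional calculus for positive operators applies, e.g. `CFC.sqrt_unique`). [folklore] -/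
theorem _root_.Literature.MathematicalPhysics.QuantumLattice.SchwingerFamily.OSSpace.shiftH_nonneg (hE1 : 𝔖.IsEuclideanCovariant) (t : ℝ) :
    0 ≤ shiftH hE2 t :=
  (ContinuousLinearMap.nonneg_iff_isPositive _).2 (isPositive_shiftH hE1 t)

/-- `‖e^{-tH}‖ ≤ 1` as an operator norm. [cite: OsterwalderSchraderCMP1973, §4.1 eq. (4.9)] -/
theorem _root_.Literature.MathematicalPhysics.QuantumLattice.SchwingerFamily.OSSpace.opNorm_shiftH_le (hE1 : 𝔖.IsEuclideanCovariant) (t : ℝ) :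
    ‖shiftH hE2 t‖ ≤ 1 :=
  ContinuousLinearMap.opNorm_le_bound _ zero_le_one fun ψ => by
    simpa using norm_shiftH_le hE1 t ψ

/-- Monotonicity of the diagonal matrix elements: `⟪ψ, e^{-tH}ψ⟫ ≤ ⟪ψ, e^{-sH}ψ⟫` for
`0 ≤ s ≤ t` (real parts; both are real), since `‖e^{-(t/2)H}ψ‖ ≤ ‖e^{-(s/2)H}ψ‖`. [folklore] -/
theorem _root_.Literature.MathematicalPhysics.QuantumLattice.SchwingerFamily.OSSpace.re_inner_shiftH_self_antitone (hE1 : 𝔖.IsEuclideanCovariant) (ψ : OSHilbert 𝔖 hE2) {s t : ℝ}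
    (hs : 0 ≤ s) (hst : s ≤ t) :
    RCLike.re ⟪ψ, shiftH hE2 t ψ⟫_ℂ ≤ RCLike.re ⟪ψ, shiftH hE2 s ψ⟫_ℂ := by
  have ht : 0 ≤ t := hs.trans hst
  rw [inner_shiftH_self_eq_norm_sq hE1 ht, inner_shiftH_self_eq_norm_sq hE1 hs]
  simp only [RCLike.re_to_complex, Complex.ofReal_re]
  refine pow_le_pow_left₀ (norm_nonneg _) ?_ 2
  have h : shiftH hE2 (t / 2) ψ = shiftH hE2 ((t - s) / 2) (shiftH hE2 (s / 2) ψ) := by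
    rw [← shiftH_add_apply hE1 (by linarith) (by positivity)]
    congr 1; ring
  rw [h]
  exact norm_shiftH_le hE1 _ _

/-! ## The orbit kernel is positive definite on the semigroup `(ℝ≥0, +)` -/

/-- **Positive-definiteness of `t ↦ ⟪ψ, e^{-tH}ψ⟫` on the additive semigroup `[0, ∞)`**: for
finitely many `tᵢ ≥ 0` and coefficients `cᵢ`,
`∑ᵢⱼ c̄ᵢ cⱼ ⟪ψ, e^{-(tᵢ+tⱼ)H} ψ⟫ = ‖∑ⱼ cⱼ e^{-tⱼH} ψ‖²`, in particular it is `≥ 0`. This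
(with boundedness and continuity, proved above) is the hypothesis of the Bernstein–Widder
theorem giving `⟪ψ, e^{-tH}ψ⟫ = ∫ e^{-tλ} dμ_ψ(λ)` — the scalar form of OS's holomorphic
semigroup `T^τ`, `Re τ ≥ 0` (Osterwalder–Schrader I (1973), p. 92). [folklore] -/
theorem _root_.Literature.MathematicalPhysics.QuantumLattice.SchwingerFamily.OSSpace.sum_sum_inner_shiftH_add_eq (hE1 : 𝔖.IsEuclideanCovariant) (ψ : OSHilbert 𝔖 hE2) {ι' : Type*}
    (s : Finset ι') (t : ι' → ℝ) (ht : ∀ i ∈ s, 0 ≤ t i) (c : ι' → ℂ) :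
    ∑ i ∈ s, ∑ j ∈ s, conj (c i) * c j * ⟪ψ, shiftH hE2 (t i + t j) ψ⟫_ℂ =
      ⟪∑ i ∈ s, c i • shiftH hE2 (t i) ψ, ∑ j ∈ s, c j • shiftH hE2 (t j) ψ⟫_ℂ := by
  rw [sum_inner (𝕜 := ℂ)]
  refine Finset.sum_congr rfl fun i hi => ?_
  rw [inner_sum (𝕜 := ℂ)]
  refine Finset.sum_congr rfl fun j hj => ?_
  rw [inner_smul_left, inner_smul_right, inner_shiftH_left hE1 (ht i hi),
    ← shiftH_add_apply hE1 (ht i hi) (ht j hj)]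
  ring

/-- The positive-definiteness inequality itself: `0 ≤ ∑ᵢⱼ c̄ᵢ cⱼ ⟪ψ, e^{-(tᵢ+tⱼ)H} ψ⟫` for
`tᵢ ≥ 0`. [folklore] -/
theorem _root_.Literature.MathematicalPhysics.QuantumLattice.SchwingerFamily.OSSpace.sum_sum_inner_shiftH_add_nonneg (hE1 : 𝔖.IsEuclideanCovariant) (ψ : OSHilbert 𝔖 hE2) {ι' : Type*}
    (s : Finset ι') (t : ι' → ℝ) (ht : ∀ i ∈ s, 0 ≤ t i) (c : ι' → ℂ) :
    0 ≤ ∑ i ∈ s, ∑ j ∈ s, conj (c i) * c j * ⟪ψ, shiftH hE2 (t i + t j) ψ⟫_ℂ := by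
  rw [sum_sum_inner_shiftH_add_eq hE1 ψ s t ht c]
  exact inner_self_nonneg_complex _

end OSSpace

end SchwingerFamily

end Literature.MathematicalPhysics.QuantumFieldTheory
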